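import Summits.Ventures.Crystal3D.StickySpheres.ConeCertificates
import HarnessLib

/-!
# `C(12) = 33` from the unique 29-contact graph on 11 vertices: a kernel-checked cone certificate

Venture `Crystal3D` (cell `pub-crystal3d`, seat p3). The cell's `T(12)` certificate (p1, `step0/census/ext/T12-CHAIN.md`
Step 2; PLAN R30/R32) says: every 12-vertex graph with 34 edges and minimum degree `≥ 5` that could be relaxed-realisable
is a cone `HC29 ⊕ 5` over the unique relaxed-realisable 11-vertex graph with 29 edges (`HC29`, the contact graph of
the Holmes-Cerfon 29-contact packing of 11 balls), and each of the `462` cones is refuted — `455` because an old vertex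
keeps degree `4 < 5`, the remaining `7` by deleting a degree-`5` vertex `w` and observing that `G − w` (29 edges,
minimum degree `≥ 4`) is NOT `HC29`. This file RE-PROVES that step inside the Lean kernel, with no external tool:

* `HC29` — the graph, as an explicit symmetric Boolean table (`HC29Data.rows`, vertex `i` adjacent to the set bits of
  `rows[i]`; graph6 `J?hicex\m^_` in p1's files), its degree sequence `4,4,4,4,5,5,5,5,7,7,8` and `29` edges;
* `HC29Cert.test` / `HC29Cert.test_all` — for every bitmask `c < 2^11` (every `S ⊆ Fin 11`): if `|S| = 5` and the cone
  `HC29 ⊕ S` has all degrees `≥ 5`, then some vertex `w` of degree `5` has a number of degree-`5` neighbours `≠ 4`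
  (checked by `decide`, kernel reduction only). Since `HC29` has exactly `4` vertices of degree `4`, the degree-count
  lookup (`ConeCertificates.card_adjDegree_eq_of_iso`) shows `G − w ≇ HC29`;
* **`graphStratum_twelve_of_HC29`**: `CompleteListHypothesis 4 29 11 {HC29} → GraphStratumHypothesis 5 34 12` — i.e. IF
  `HC29` is (up to isomorphism) the only relaxed-realisable 11-vertex graph with 29 edges and minimum degree `≥ 4` (the
  census statement `S_11(29) = {HC29}`, certified in the cell by two routes: E1's complete `m = 29` stratum and p1's
  extension chain from the signed `n = 10` lists), THEN no 12-vertex graph with 34 edges and minimum degree `≥ 5` is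
  relaxed-realisable;
* **`maxContacts_three_twelve_of_HC29`**: `C(12) = 33` from the graph strata `GSH(4,19,8)`, `GSH(4,22,9)`, `GSH(5,26,10)`,
  `GSH(5,30,11)` (rows `n = 8..11`, as in `GraphStratum.lean`) and `S_11(29) = {HC29}` — the extension script, the
  canonical-form deduplication and the deletion decider of the cell's T(12) certificate are thereby REMOVED from the
  trust base of the `n = 12` row: only census statements remain as hypotheses.

HONEST FRAMING: the hypotheses are NOT proved here (they are the cell's certified-enumeration statements); `33 ≤ C(12)` is
the tree's explicit witness. Kernel computation: `2^11` masks × `12²` table lookups, `decide` only, standard axioms.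
-/

namespace Summit.Ventures.Crystal3D

open Finset SimpleGraph

/-! ### 1. The graph `HC29` -/

namespace HC29Data

/-- Row bitmasks of `HC29`: vertex `i` is adjacent to `j` iff bit `j` of `rows[i]` is set. Edges:
`0-4 0-7 0-8 0-10 1-5 1-6 1-9 1-10 2-4 2-5 2-8 2-9 3-6 3-7 3-8 3-9 4-5 4-8 4-10 5-9 5-10 6-7 6-9 6-10 7-8 7-10 8-9 8-10 9-10`.
[folklore] -/
def rows : List ℕ := [1424, 1632, 816, 960, 1317, 1558, 1674, 1353, 1693, 1390, 1011]

/-- The adjacency table of `HC29`. [folklore] -/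
def adj (i j : Fin 11) : Bool := (rows.getD i.val 0).testBit j.val

/-- The table is symmetric. [folklore] -/
theorem adj_symm : ∀ i j : Fin 11, adj i j = adj j i := by decide

/-- The table is irreflexive. [folklore] -/
theorem adj_irrefl : ∀ i : Fin 11, adj i i = false := by decide

/-- The degree sequence of `HC29` (by vertex): `4,4,4,4,5,5,5,5,7,7,8`. [folklore] -/
def deg : List ℕ := [4, 4, 4, 4, 5, 5, 5, 5, 7, 7, 8]

/-- Row counts of the table are the listed degrees. [folklore] -/
theorem countP_adj : ∀ i : Fin 11, (List.finRange 11).countP (fun u => adj i u) = deg.getD i.val 0 := by decide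

/-- Exactly four rows have count `4`. [folklore] -/
theorem countP_deg_four :
    (List.finRange 11).countP (fun i => decide ((List.finRange 11).countP (fun u => adj i u) = 4)) = 4 := by decide

/-- The row counts sum to `58 = 2 · 29`. [folklore] -/
theorem sum_countP_adj : ∑ i : Fin 11, (List.finRange 11).countP (fun u => adj i u) = 58 := by decide

end HC29Data

/-- **`HC29`**: the contact graph of the 29-contact packing of 11 unit balls (Holmes-Cerfon 2016; graph6 `J?hicex\m^_`),
as a graph on `Fin 11`. [folklore] -/
def HC29 : SimpleGraph (Fin 11) := boolGraph HC29Data.adj HC29Data.adj_symm HC29Data.adj_irrefl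

/-- Decidable adjacency for `HC29` (table lookup). -/
instance HC29.decidableRel : DecidableRel HC29.Adj :=
  boolGraph.decidableRel HC29Data.adj HC29Data.adj_symm HC29Data.adj_irrefl

/-- Degrees of `HC29` as row counts. [folklore] -/
theorem degree_HC29_countP (i : Fin 11) : HC29.degree i = (List.finRange 11).countP fun u => HC29Data.adj i u :=
  degree_boolGraph HC29Data.adj HC29Data.adj_symm HC29Data.adj_irrefl i

/-- Degrees of `HC29`: `4,4,4,4,5,5,5,5,7,7,8`. [folklore] -/
theorem degree_HC29 (i : Fin 11) : HC29.degree i = HC29Data.deg.getD i.val 0 :=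
  (degree_HC29_countP i).trans (HC29Data.countP_adj i)

/-- `HC29` has exactly four vertices of degree `4`. [folklore] -/
theorem card_degree_four_HC29 : (Finset.univ.filter fun j => HC29.degree j = 4).card = 4 := by
  rw [card_filter_univ_eq_countP]
  simp only [degree_HC29_countP]
  exact HC29Data.countP_deg_four

/-- `HC29` has `29` edges. [folklore] -/
theorem card_edgeFinset_HC29 : HC29.edgeFinset.card = 29 := by
  have h := HC29.sum_degrees_eq_twice_card_edges
  simp only [degree_HC29_countP, HC29Data.sum_countP_adj] at h
  omega

/-! ### 2. The certificate and its kernel check -/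

namespace HC29Cert

/-- Degree of vertex `a` in the cone `HC29 ⊕ {i | s i}` (new vertex last), from the tables. [folklore] -/
def cdeg (s : Fin 11 → Bool) (a : Fin 12) : ℕ := (List.finRange 12).countP fun b => coneAdjB HC29Data.adj s a b

/-- The test for one indicator `s`: either `|S| ≠ 5`, or some cone degree is `< 5`, or some vertex `w` of cone degree
`5` has a number of degree-`5` neighbours different from `4`. [folklore] -/
def testS (s : Fin 11 → Bool) : Bool :=
  !(decide ((List.finRange 11).countP s = 5)) ||
  !((List.finRange 12).all fun a => decide (5 ≤ cdeg s a)) ||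
  (List.finRange 12).any fun w => decide (cdeg s w = 5) &&
    !(decide (((List.finRange 12).countP fun v => coneAdjB HC29Data.adj s w v && decide (cdeg s v = 5)) = 4))

/-- The test on a bitmask. [folklore] -/
def test (c : ℕ) : Bool := testS (maskFun c)

/-- **All `2^11` subsets pass the test.** Kernel computation (`decide`). [folklore] -/
theorem test_all : (List.range 2048).all test = true := by decide +kernel

/-- Hence every `S ⊆ Fin 11` passes the test, stated on its indicator. [folklore] -/
theorem testS_decide_mem (S : Finset (Fin 11)) : testS (fun i => decide (i ∈ S)) = true := by
  have h := List.all_eq_true.1 test_all (∑ j ∈ S, 2 ^ (j : ℕ)) (sum_two_pow_val_mem_range S)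
  rwa [test, maskFun_sum_two_pow] at h

end HC29Cert

/-! ### 3. Soundness: the cone check of `ExtensionStep` for `L = {HC29}` -/

/-- **The cone check for `HC29 ⊕ 5`.** Assuming `S_11(29) = {HC29}` as a complete list (minimum degree `≥ 4`): no cone
`coneGraph (Fin.last 11) HC29 S` with `|S| = 5` and all degrees `≥ 5` is relaxed-realisable. [folklore] -/
theorem not_relaxedRealisable_cone_HC29 (hL : CompleteListHypothesis 4 29 11 {HC29}) :
    ∀ H ∈ ({HC29} : Set (SimpleGraph (Fin 11))), ∀ [DecidableRel H.Adj], ∀ S : Finset (Fin 11), S.card = 5 →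
      (∀ a, 5 ≤ (coneGraph (Fin.last 11) H S).degree a) → ¬ RelaxedRealisable (coneGraph (Fin.last 11) H S) := by
  intro H hH inst S hS hmin hRR
  rw [Set.mem_singleton_iff] at hH
  subst hH
  have hinst : inst = HC29.decidableRel := Subsingleton.elim _ _
  subst hinst
  -- the cone is the table graph of the cone table
  set s : Fin 11 → Bool := fun i => decide (i ∈ S) with hs
  let G' : SimpleGraph (Fin 12) :=
    boolGraph (coneAdjB HC29Data.adj s) (coneAdjB_symm _ HC29Data.adj_symm s) (coneAdjB_irrefl _ HC29Data.adj_irrefl s)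
  have hEq : coneGraph (Fin.last 11) HC29 S = G' := by
    conv_lhs => rw [eq_filter_decide_mem S]
    exact coneGraph_boolGraph HC29Data.adj HC29Data.adj_symm HC29Data.adj_irrefl s
  have hdegG' : ∀ a, G'.degree a = HC29Cert.cdeg s a := fun a => degree_boolGraph _ _ _ a
  have hmin' : ∀ a, 5 ≤ G'.degree a := fun a => by
    rw [← degree_congr_of_eq hEq a]
    exact hmin a
  have hRR' : RelaxedRealisable G' := hEq ▸ hRR
  have hcardG' : G'.edgeFinset.card = 34 := by
    rw [← card_edgeFinset_congr_of_eq hEq, card_edgeFinset_coneGraph, card_edgeFinset_HC29, hS]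
  -- unpack the kernel certificate
  have ht := HC29Cert.testS_decide_mem S
  rw [← hs] at ht
  have h1 : (List.finRange 11).countP s = 5 := by rw [hs, ← card_eq_countP_decide_mem S, hS]
  have h2 : ((List.finRange 12).all fun a => decide (5 ≤ HC29Cert.cdeg s a)) = true := by
    rw [List.all_eq_true]
    intro a _
    rw [decide_eq_true_eq, ← hdegG' a]
    exact hmin' a
  rw [HC29Cert.testS, h1, h2] at ht
  simp only [decide_true, Bool.not_true, Bool.false_or, List.any_eq_true, Bool.and_eq_true, decide_eq_true_eq,
    Bool.not_eq_true', decide_eq_false_iff_not] at ht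
  obtain ⟨w, -, hw5, hne⟩ := ht
  -- `w` has degree 5; `G' − w` has 29 edges and minimum degree ≥ 4, so it is `≅ HC29` by the complete list
  rw [← hdegG' w] at hw5
  have he : (G'.comap w.succAbove).edgeFinset.card = 29 := by
    rw [card_edgeFinset_comap_succAbove, hcardG', hw5]
  have hd : ∀ j, 4 ≤ (G'.comap w.succAbove).degree j := fun j =>
    le_trans (by have := hmin' (w.succAbove j); omega) (degree_sub_one_le_degree_comap_succAbove G' w j)
  obtain ⟨H, hH, ⟨φ⟩⟩ := hL (G'.comap w.succAbove) he hd (hRR'.deleteVertex w)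
  rw [Set.mem_singleton_iff] at hH
  subst hH
  -- degree-count lookup: `w` must have exactly 4 neighbours of degree 5 — contradiction with the certificate
  have hcount := card_adjDegree_eq_of_iso G' w hmin' (by norm_num) φ
  rw [show 5 - 1 = 4 from rfl, card_degree_four_HC29, card_filter_univ_eq_countP] at hcount
  have key : (fun v => coneAdjB HC29Data.adj s w v && decide (HC29Cert.cdeg s v = 5)) =
      (fun v => decide (G'.Adj w v ∧ G'.degree v = 5)) := by
    funext v
    rw [Bool.decide_and, hdegG' v, decide_boolGraph_adj]
  exact hne (by rw [key, hcount])

/-! ### 4. The row `n = 12` -/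

/-- **`GSH(5, 34, 12)` from `S_11(29) = {HC29}`.** If `HC29` is, up to isomorphism, the only relaxed-realisable graph on
`11` vertices with `29` edges and minimum degree `≥ 4`, then no graph on `12` vertices with `34` edges and minimum
degree `≥ 5` is relaxed-realisable. (Lemma R6 + the kernel-checked cone certificate.) [folklore] -/
theorem graphStratum_twelve_of_HC29 (hL : CompleteListHypothesis 4 29 11 {HC29}) : GraphStratumHypothesis 5 34 12 :=
  graphStratum_twelve_of_coneExtensions {HC29} hL (not_relaxedRealisable_cone_HC29 hL)

/-- **`C(12) = 33`** from the graph strata of the rows `n = 8, …, 11` and the single complete-list statement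
`S_11(29) = {HC29}`. All five hypotheses are census statements; `33 ≤ C(12)` is the tree's witness. [folklore] -/
theorem maxContacts_three_twelve_of_HC29 (h8 : GraphStratumHypothesis 4 19 8) (h9 : GraphStratumHypothesis 4 22 9)
    (h10 : GraphStratumHypothesis 5 26 10) (h11 : GraphStratumHypothesis 5 30 11)
    (hL : CompleteListHypothesis 4 29 11 {HC29}) : maxContacts 3 12 = 33 :=
  maxContacts_three_twelve_of_graphStrata h8 h9 h10 h11 (graphStratum_twelve_of_HC29 hL)

end Summit.Ventures.Crystal3D
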